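import Literature.MathematicalPhysics.QuantumFieldTheory.Balaban1983to89.B10Eq61SpineCoefficient
import Literature.MathematicalPhysics.QuantumFieldTheory.Balaban1983to89.LogChartClosedSubgroup

/-!
# `Balaban1983to89.B10Eq61CoefficientOnLie` — T. Bałaban, *Ultraviolet stability of three-dimensional lattice pure gauge
# field theories*, Commun. Math. Phys. **102** (1985) 255–275 [Balaban1985UV3], p. 271 (after (62)): «More exactly the
# coefficient is a linear operator S(V^{(k)}, b₀(c)) acting on the Lie algebra 𝔤, see the formula (124) [4] for a
# precise definition» — the `𝔤`-STABILITY of the full `b₀(c)`-coefficient (the hypothesis `h𝔤` of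
# `B10Eq61SpineCoefficient.fullCoeffOn`) DERIVED, for backgrounds with values in a log-charted gauge group

statement-level skeleton of published theorems with citation tags; proofs where landed; nothing here is a claim
about the Yang–Mills mass gap

WHAT IS REPRODUCED.  Mega-formalization `lit-balaban` (HOME `run/shared/lean/pub/lit-balaban/`), unit `lit-balaban-r07`
gen 36 (B10 fold owner), row B10.Eq61 member.  `B10Eq61SpineCoefficient` (v1.1–v1.5) defines the full `b₀(c)`-coefficient
`S(V₀, b₀(c)) : X ↦ L(Q(V₀)·)_c` applied to the single-bond field `X` on `b₀(c)` (`fullCoeff`, the directional derivative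
of the one-step covariant average (121) of [4]) and restricts it to a finite-dimensional real `𝔤 ⊂ 𝔸` (`fullCoeffOn`)
UNDER THE HYPOTHESIS `h𝔤 : ∀ X ∈ 𝔤, fullCoeff L V₀ y κ X ∈ 𝔤` — its docstring: «on the lineage's abstract algebra `𝔸`
this is not derived — it would follow from the group-valuedness of the averaging (121), not typed».  THIS FILE DERIVES
IT: for a background `V₀` with values in a subgroup `H ≤ 𝔸ˣ` and a real subspace `𝔤` related to `H` as a Lie group to
its Lie algebra through the exponential/logarithmic chart of [4] p. 20–21 — «The group G is obtained by applying the
function e^{iA} to A ∈ 𝔤» (p. 20) and the logarithm (21)–(23) p. 21 taking group elements near `1` back to `𝔤` —, the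
covariant average `Q(V₀, tA, c)` of a `𝔤`-valued `A` is `𝔤`-valued for small real `t`, hence so is its `t`-derivative
`L(Q(V₀)A)_c` (a closed subspace contains the derivatives of its curves), and in particular `S(V₀, b₀(c))𝔤 ⊆ 𝔤`.

THE PRINTED INPUTS.  [Balaban1985UV3] p. 271, quoted above.  [Balaban1985Averaging] = [4], p. 20: «We consider a Lie
subgroup G of a unitary group U(N). Its Lie algebra 𝔤 is a subalgebra of the algebra of hermitian matrices. … The
group G is obtained by applying the function e^{iA} to A ∈ 𝔤»; p. 21 (21): «It is an inverse to the exponential function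
and for matrices X satisfying |X − 1| < 1 it is given by log X = Σ_{n≥1} (−1)^{n+1}(1/n)(X − 1)ⁿ», (22)–(23) (the
logarithm of unitary matrices); (42) p. 23, (58)–(65) pp. 27–29, (89) p. 31, (121)–(122) p. 36 (the objects averaged:
every one of them is a product of bond variables, exponentials of real combinations of logarithms of such products, and
conjugates — so it stays in `G` when the bond variables are in `G` and the logarithms are taken inside the chart).

THE ARGUMENT FORMALISED ([folklore] Lie-group bookkeeping; the chart is the tree's `LogChart` of
`BlockAveragingFederbushGValued`/`LogChartClosedSubgroup`, [Hall2015] Thm. 3.42).  Hypotheses on `(H, 𝔤, ρ)`: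
(E) `exp 𝔤 ⊆ H` (`hE`), (Λ) `log u ∈ 𝔤` for `u ∈ H`, `‖u − 1‖ ≦ ρ` (`hΛ`), `𝔤` closed (`h𝔤c`).  (1) MEMBERSHIP: for
`H`-valued `V₀`, `V₁` every transport `V(Γ)` is in `H` (`B7Prop2Explicit.hol_mem_of`), hence the block loops `W_x` (42),
the twisted transports (58); their logarithms are in `𝔤` when they lie within `ρ` of `1`, so the exponents `X_c` (42) and
`F(y)` (62)/(82) are in `𝔤` (real weights `L^{−d}`), the averages `V̄_c`, the frames, `Ṽ₁(c)` (65) and the double-bar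
average `V̿₁(c)` (89) are in `H`, and `Q(V₀, A, c) = log V̿₁(c)` (121) is in `𝔤` when `V̿₁(c)` is within `ρ` of `1`
(`Qcov_mem`).  (2) SMALLNESS ALONG THE RAY `V₁ = e^{sA}`, `s` real: at `s = 0` the block loops are those of `V₀` (assumed
within `ρ` of `1`: `hWρ`, the chart-sized form of the regularity (109)/(44) by Prop. 1 of [4]), the twisted transports and
`V̿₁` equal `1`; by continuity (the lineage's derivative lemmas `hasDerivAt_Wcx_expCfg`, `hasDerivAt_tHol_expCfg`,
`hasDerivAt_wframe_expCfg`, `hasDerivAt_tild_expCfg` restricted to the real ray) they stay within `ρ` for small `s`, so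
`Q(V₀, sA, c) ∈ 𝔤` eventually (`eventually_Qcov_mem`).  (3) THE DERIVATIVE: `L(Q(V₀)A)_c` is the `t`-derivative of
`Q(V₀, tA, c)` at `0` (`linQcov`, `hasDerivAt_Qcov`), i.e. the limit of `s⁻¹·Q(V₀, sA, c) ∈ 𝔤` along real `s → 0`; `𝔤` is
closed, so `L(Q(V₀)A)_c ∈ 𝔤` (`linQcov_mem`), and with `A` = the single-bond field: `S(V₀, b₀(c))X ∈ 𝔤` for `X ∈ 𝔤`
(`fullCoeff_mem`).

WHAT THIS FILE PROVES (theorems only; 0 `sorry`; standard axioms; no definition, no new named fact):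
* §1 MEMBERSHIP (hypotheses (E), (Λ)): `expCfg_mem`, `Wcx_mem`, `Xavg_mem`, `bavg_mem`, `tHol_mem`, `Fcov_mem`,
  `wframe_mem`, `tild_mem`, `dbavgCov_mem`, **`Qcov_mem`** (private [folklore] plumbing: products, conjugates, the
  single-bond field, the real ray inside the complex parameter).
* §2 THE REAL RAY: `eventually_norm_Wcx_expCfg_le`, `eventually_norm_tHol_expCfg_le`, `continuousAt_dbavgCov_expCfg`,
  `eventually_norm_dbavgCov_expCfg_le`, **`eventually_Qcov_mem`** (`Q(V₀, sA, c) ∈ 𝔤` for small real `s`).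
* §3 **`linQcov_mem`** (`L(Q(V₀)A)_c ∈ 𝔤` for `𝔤`-valued `A`, `H`-valued `V₀` with block loops within `min(1, ρ)` of `1`),
  **`fullCoeff_mem`** (= the hypothesis `h𝔤` of `B10Eq61SpineCoefficient.fullCoeffOn`, DERIVED).
* §4 THE DICTIONARY TO THE TREE'S `LogChart` ([Hall2015] Thm. 3.42 as data; `LogChartClosedSubgroup` proves every closed
  linear group carries one): for `G : LogChart 𝔸` and the subgroup `H ≤ 𝔸ˣ` of units lying in `G` (`hHG`), (E) and (Λ)
  hold with `𝔤 = G.lie`, `ρ = G.ρ` (`expUnit_mem_of_logChart`, `mlog_mem_of_logChart`), `G.lie` IS CLOSED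
  (`LogChart.isClosed_lie`, from `LogChart.mem_lie_iff_forall_exp_smul_mem`) and `Ad(H)`-STABLE (`LogChart.conjR_mem_lie`
  — the hypothesis `hst` of `B10Eq61SpineCoefficient` §9, also derived); **`fullCoeff_mem_lie`**, `linQcov_mem_lie`; and
  from the PLAQUETTE regularity (44)/(109) alone, by Prop. 1 of [4] in the lineage's quantified form
  `B7Prop2Explicit.norm_Wcx_sub_one_le`: `norm_Wcx_sub_one_lt_of_plaquette`, **`fullCoeff_mem_lie_of_plaquette`**
  (`|V₀(∂p) − 1| ≦ α₀`, `512(d+1)(d+4)L²α₀ ≦ 1`, `16(d+1)(d+4)L²α₀ < ρ_G`).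
* §5 CONSEQUENCES FOR (61): **`det_fullCoeffOn_ne_zero_of_logChart`**, `fullCoeffOn_bijective_of_logChart`,
  `abs_det_fullCoeffOn_gaugeAct_of_logChart` — §9c/§9d of `B10Eq61SpineCoefficient` with `h𝔤` (and `hst`) SUPPLIED, for
  every `H`-valued regular background, `H` the group of a log-chart; §5b `fullCoeff_mem_lie_of_isClosed` (finite-dimensional
  `𝔸`: every subgroup of `𝔸ˣ` closed in `𝔸`, with its Hall Lie algebra `{X | e^{tX} ∈ H ∀ t}`, by `unitsSubgroupLogChart`);
  §5c print's ambient group `U(N)` with `𝔲(N)` and the EXPLICIT radius `1/3` of the tree's `unitaryLogChart`: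
  **`fullCoeff_mem_skewAdjoint`** (`S(V₀, b₀(c))𝔲(N) ⊆ 𝔲(N)` for unitary backgrounds with block loops within `1/3` of `1`),
  **`det_fullCoeffOn_ne_zero_unitary`** (`det S(V₀, b₀(c))|_{𝔲(N)} ≠ 0`, every `𝔤`-hypothesis discharged).
* §6 «simple, LOCAL, gauge invariant functions of V^{(k)}» (p. 271), the locality clause: `linQcov_congr`,
  **`fullCoeff_congr`**, `det_fullCoeffOn_congr` — backgrounds agreeing on the bonds of `B(c₋) ∪ B(c₊)` have the same
  coefficient and the same `det S|_𝔤` (by name from the lineage's `B7LocalityGeneral.Qcov_congr`, [4] p. 34).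

HONEST SCOPE.  (i) The regularity hypothesis is `‖W_x(V₀) − 1‖ < ρ` on the block `B(c₋)` with `ρ` the chart radius (for
`U(N)` the tree's radius is `1/3`; for a general closed `G` some `ρ_G > 0`, not explicit) — by Prop. 1 of [4] this is the
regime `16(d+1)(d+4)L²α₀ < ρ` of the plaquette regularity (44)/(109), print's «α₀ sufficiently small»
(`fullCoeff_mem_lie_of_plaquette`, by name from `B7Prop2Explicit.norm_Wcx_sub_one_le`).  (ii) `ℤ^d` carrier, one
averaging step, as in `B10Eq61SpineCoefficient` (HONEST SCOPE (ii) there).  (iii) What is derived is the STABILITY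
`S(V₀, b₀(c))𝔤 ⊆ 𝔤` (and `Ad(H)𝔤 ⊆ 𝔤`); the sign of `det S` is still not asserted (ref-5's DECLARED DIVERGENCE on the
`|det|` reading stands).  (iv) KIND (G.5-54 [i]): derived member over the lineage's concrete objects; print states the
conclusion («acting on the Lie algebra 𝔤») without proof.  NOT summit progress.
-/

noncomputable section

open scoped BigOperators
open NormedSpace Finset Filter Topology

namespace Literature.MathematicalPhysics.QuantumFieldTheory.Balaban1983to89.B10Eq61CoefficientOnLie

open B7Prop1Explicit B7Prop3Flat B7Eq92Concrete MatrixLog B7Prop3GeneralRotated B7Prop3GeneralLinear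
open B7Prop3GeneralTild (hasDerivAt_Wcx_expCfg hasDerivAt_tild_expCfg hasDerivAt_Qcov linQcov_eq)
open B7Eq125RightInverse (corner spineSite)
open B7Eq78Linearization (conjR conjR_apply conjR_smul_real hasDerivAt_conjR_comp)
open B7Prop2Explicit (hol_mem_of norm_Wcx_sub_one_le)
open B10Eq61SpineCoefficient (bondField fullCoeff fullCoeffOn fullCoeffOn_bijective det_fullCoeffOn_ne_zero
  abs_det_fullCoeffOn_gaugeAct)

-- `Site` alone would resolve to the torus sites of `Setup.lean`; re-export the `ℤ^d` sites of `B7Prop1Explicit`.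
export B7Prop1Explicit (Site)

variable {d : ℕ}

/-! ## §1 Membership: `G`-valued bond variables give `G`-valued averages and `𝔤`-valued logarithms ([4] p. 20–21) -/

section Membership

variable {𝔸 : Type*} [NormedRing 𝔸] [NormedAlgebra ℂ 𝔸] [CompleteSpace 𝔸]
variable {L : ℕ} {H : Subgroup 𝔸ˣ} {𝔤 : Submodule ℝ 𝔸} {ρ : ℝ}

/-- `e^{A}` is `H`-valued for a `𝔤`-valued `A` — «The group G is obtained by applying the function e^{iA} to A ∈ 𝔤».
[cite: Balaban1985Averaging, p.20] -/
theorem expCfg_mem (hE : ∀ X ∈ 𝔤, expUnit X ∈ H) {A : Site d → Fin d → 𝔸} (hA : ∀ z μ, A z μ ∈ 𝔤) :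
    ∀ z μ, expCfg A z μ ∈ H := fun z μ => hE _ (hA z μ)

/-- … and so is `e^{sA}` for real `s` (the real ray in the complex parameter of the lineage).
[cite: Balaban1985Averaging, p.20] -/
theorem expCfg_real_smul_mem (hE : ∀ X ∈ 𝔤, expUnit X ∈ H) {A : Site d → Fin d → 𝔸} (hA : ∀ z μ, A z μ ∈ 𝔤)
    (s : ℝ) : ∀ z μ, expCfg ((s : ℂ) • A) z μ ∈ H :=
  expCfg_mem hE fun z μ => by
    rw [Pi.smul_apply, Pi.smul_apply, Complex.coe_smul]
    exact 𝔤.smul_mem s (hA z μ)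

omit [NormedAlgebra ℂ 𝔸] [CompleteSpace 𝔸] in
/-- products of `H`-valued configurations are `H`-valued. [folklore] -/
private theorem mul_cfg_mem {V₁ V₀ : Site d → Fin d → 𝔸ˣ} (hV₁ : ∀ z μ, V₁ z μ ∈ H) (hV₀ : ∀ z μ, V₀ z μ ∈ H) :
    ∀ z μ, (V₁ * V₀) z μ ∈ H := fun z μ => H.mul_mem (hV₁ z μ) (hV₀ z μ)

omit [NormedAlgebra ℂ 𝔸] [CompleteSpace 𝔸] in
/-- the block loop `V(Γ_{c,x})V(c)⁻¹` (42) of an `H`-valued `V` is in `H`. [cite: Balaban1985Averaging, (42) p.23] -/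
theorem Wcx_mem {V : Site d → Fin d → 𝔸ˣ} (hV : ∀ z μ, V z μ ∈ H) (q : Site d) (κ : Fin d) (r : Site d) :
    Wcx L V q κ r ∈ H :=
  H.mul_mem (hol_mem_of hV _ _) (H.inv_mem (hol_mem_of hV _ _))

omit [CompleteSpace 𝔸] in
/-- the exponent `X_c = Σ_x L^{−d} log V(Γ_{c,x})V(c)⁻¹` of (42) is in `𝔤` when the block loops lie in the logarithmic
chart. [cite: Balaban1985Averaging, (42) p.23, (21)-(23) p.21] -/
theorem Xavg_mem (hΛ : ∀ u : 𝔸ˣ, u ∈ H → ‖(u : 𝔸) - 1‖ ≤ ρ → mlog (u : 𝔸) ∈ 𝔤) {V : Site d → Fin d → 𝔸ˣ}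
    (hV : ∀ z μ, V z μ ∈ H) (q : Site d) (κ : Fin d)
    (hWρ : ∀ r : Fin d → Fin L, ‖((Wcx L V q κ (boxVec L r) : 𝔸ˣ) : 𝔸) - 1‖ ≤ ρ) : Xavg L V q κ ∈ 𝔤 := by
  unfold Xavg
  exact 𝔤.sum_mem fun r _ => 𝔤.smul_mem _ (hΛ _ (Wcx_mem hV q κ _) (hWρ r))

/-- **the average `V̄_c` (42) of an `H`-valued configuration is in `H`** (block loops inside the chart).
[cite: Balaban1985Averaging, (42) p.23, p.20] -/
theorem bavg_mem (hE : ∀ X ∈ 𝔤, expUnit X ∈ H) (hΛ : ∀ u : 𝔸ˣ, u ∈ H → ‖(u : 𝔸) - 1‖ ≤ ρ → mlog (u : 𝔸) ∈ 𝔤)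
    {V : Site d → Fin d → 𝔸ˣ} (hV : ∀ z μ, V z μ ∈ H) (q : Site d) (κ : Fin d)
    (hWρ : ∀ r : Fin d → Fin L, ‖((Wcx L V q κ (boxVec L r) : 𝔸ˣ) : 𝔸) - 1‖ ≤ ρ) : bavg L V q κ ∈ H :=
  H.mul_mem (hE _ (Xavg_mem hΛ hV q κ hWρ)) (hol_mem_of hV _ _)

omit [NormedAlgebra ℂ 𝔸] [CompleteSpace 𝔸] in
/-- the twisted transport `(R_{0,y}V₁)(Γ) = (V₁V₀)(Γ)V₀(Γ)⁻¹` (58) is in `H`. [cite: Balaban1985Averaging, (58) p.27] -/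
theorem tHol_mem {V₀ V₁ : Site d → Fin d → 𝔸ˣ} (hV₀ : ∀ z μ, V₀ z μ ∈ H) (hV₁ : ∀ z μ, V₁ z μ ∈ H) (y : Site d)
    (w : List (Letter d)) : tHol V₀ V₁ y w ∈ H :=
  H.mul_mem (hol_mem_of (mul_cfg_mem hV₁ hV₀) _ _) (H.inv_mem (hol_mem_of hV₀ _ _))

omit [CompleteSpace 𝔸] in
/-- the frame exponent `F(y) = Σ_x L^{−d} log (R_{0,y}V₁)(Γ_{y,x})` (62)/(82) is in `𝔤` when the twisted transports lie in
the chart. [cite: Balaban1985Averaging, (62) p.28, (82) p.30, (21)-(23) p.21] -/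
theorem Fcov_mem (hΛ : ∀ u : 𝔸ˣ, u ∈ H → ‖(u : 𝔸) - 1‖ ≤ ρ → mlog (u : 𝔸) ∈ 𝔤) {V₀ V₁ : Site d → Fin d → 𝔸ˣ}
    (hV₀ : ∀ z μ, V₀ z μ ∈ H) (hV₁ : ∀ z μ, V₁ z μ ∈ H) (y : Site d)
    (htρ : ∀ r : Fin d → Fin L, ‖((tHol V₀ V₁ y (treeWord (boxVec L r)) : 𝔸ˣ) : 𝔸) - 1‖ ≤ ρ) :
    Fcov L V₀ V₁ y ∈ 𝔤 := by
  unfold Fcov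
  exact 𝔤.sum_mem fun r _ => 𝔤.smul_mem _ (hΛ _ (tHol_mem hV₀ hV₁ y _) (htρ r))

/-- the block frame `\overline{R_{0,y}V₁} = exp F(y)` is in `H`. [cite: Balaban1985Averaging, (82) p.30, p.20] -/
theorem wframe_mem (hE : ∀ X ∈ 𝔤, expUnit X ∈ H) (hΛ : ∀ u : 𝔸ˣ, u ∈ H → ‖(u : 𝔸) - 1‖ ≤ ρ → mlog (u : 𝔸) ∈ 𝔤)
    {V₀ V₁ : Site d → Fin d → 𝔸ˣ} (hV₀ : ∀ z μ, V₀ z μ ∈ H) (hV₁ : ∀ z μ, V₁ z μ ∈ H) (y : Site d)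
    (htρ : ∀ r : Fin d → Fin L, ‖((tHol V₀ V₁ y (treeWord (boxVec L r)) : 𝔸ˣ) : 𝔸) - 1‖ ≤ ρ) :
    wframe L V₀ V₁ y ∈ H :=
  hE _ (Fcov_mem hΛ hV₀ hV₁ y htρ)

/-- `Ṽ₁(c) = (\overline{V₁V₀})_c(V̄₀)_c⁻¹` (65) is in `H`. [cite: Balaban1985Averaging, (65) p.29] -/
theorem tild_mem (hE : ∀ X ∈ 𝔤, expUnit X ∈ H) (hΛ : ∀ u : 𝔸ˣ, u ∈ H → ‖(u : 𝔸) - 1‖ ≤ ρ → mlog (u : 𝔸) ∈ 𝔤)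
    {V₀ V₁ : Site d → Fin d → 𝔸ˣ} (hV₀ : ∀ z μ, V₀ z μ ∈ H) (hV₁ : ∀ z μ, V₁ z μ ∈ H) (q : Site d) (κ : Fin d)
    (hWρ₁ : ∀ r : Fin d → Fin L, ‖((Wcx L (V₁ * V₀) q κ (boxVec L r) : 𝔸ˣ) : 𝔸) - 1‖ ≤ ρ)
    (hWρ₀ : ∀ r : Fin d → Fin L, ‖((Wcx L V₀ q κ (boxVec L r) : 𝔸ˣ) : 𝔸) - 1‖ ≤ ρ) :
    tild L V₀ V₁ q κ ∈ H :=
  H.mul_mem (bavg_mem hE hΛ (mul_cfg_mem hV₁ hV₀) q κ hWρ₁) (H.inv_mem (bavg_mem hE hΛ hV₀ q κ hWρ₀))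

omit [NormedAlgebra ℂ 𝔸] [CompleteSpace 𝔸] in
/-- conjugates `R(X)Y = XYX⁻¹` stay in `H`. [folklore] -/
private theorem Rc_mem {X Y : 𝔸ˣ} (hX : X ∈ H) (hY : Y ∈ H) : Rc X Y ∈ H := by
  rw [Rc_apply]
  exact H.mul_mem (H.mul_mem hX hY) (H.inv_mem hX)

/-- **the double-bar average `V̿₁(c)` (89) of `H`-valued `V₀`, `V₁` is in `H`** (block loops of `V₁V₀` and `V₀` at `c`,
twisted transports at `c₋`, `c₊` inside the chart). [cite: Balaban1985Averaging, (89) p.31, p.20] -/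
theorem dbavgCov_mem (hE : ∀ X ∈ 𝔤, expUnit X ∈ H) (hΛ : ∀ u : 𝔸ˣ, u ∈ H → ‖(u : 𝔸) - 1‖ ≤ ρ → mlog (u : 𝔸) ∈ 𝔤)
    {V₀ V₁ : Site d → Fin d → 𝔸ˣ} (hV₀ : ∀ z μ, V₀ z μ ∈ H) (hV₁ : ∀ z μ, V₁ z μ ∈ H) (q : Site d) (κ : Fin d)
    (hWρ₁ : ∀ r : Fin d → Fin L, ‖((Wcx L (V₁ * V₀) q κ (boxVec L r) : 𝔸ˣ) : 𝔸) - 1‖ ≤ ρ)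
    (hWρ₀ : ∀ r : Fin d → Fin L, ‖((Wcx L V₀ q κ (boxVec L r) : 𝔸ˣ) : 𝔸) - 1‖ ≤ ρ)
    (htm : ∀ r : Fin d → Fin L, ‖((tHol V₀ V₁ q (treeWord (boxVec L r)) : 𝔸ˣ) : 𝔸) - 1‖ ≤ ρ)
    (htp : ∀ r : Fin d → Fin L, ‖((tHol V₀ V₁ (q + (L : ℤ) • e κ) (treeWord (boxVec L r)) : 𝔸ˣ) : 𝔸) - 1‖ ≤ ρ) :
    dbavgCov L V₀ V₁ q κ ∈ H := by
  rw [dbavgCov_apply]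
  exact H.mul_mem (H.mul_mem (H.inv_mem (wframe_mem hE hΛ hV₀ hV₁ q htm)) (tild_mem hE hΛ hV₀ hV₁ q κ hWρ₁ hWρ₀))
    (Rc_mem (bavg_mem hE hΛ hV₀ q κ hWρ₀) (wframe_mem hE hΛ hV₀ hV₁ _ htp))

/-- **`Q(V₀, A, c) = log V̿₁(c)` (121) IS IN `𝔤`** for a `𝔤`-valued `A` and an `H`-valued `V₀`, when the objects above lie in
the chart and `V̿₁(c)` is within `ρ` of `1`. [cite: Balaban1985Averaging, (121) p.36, (21)-(23) p.21, p.20]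
[cite: Balaban1985UV3, p.271 (after (62))] -/
theorem Qcov_mem (hE : ∀ X ∈ 𝔤, expUnit X ∈ H) (hΛ : ∀ u : 𝔸ˣ, u ∈ H → ‖(u : 𝔸) - 1‖ ≤ ρ → mlog (u : 𝔸) ∈ 𝔤)
    {V₀ : Site d → Fin d → 𝔸ˣ} (hV₀ : ∀ z μ, V₀ z μ ∈ H) {A : Site d → Fin d → 𝔸} (hA : ∀ z μ, A z μ ∈ 𝔤)
    (q : Site d) (κ : Fin d)
    (hWρ₁ : ∀ r : Fin d → Fin L, ‖((Wcx L (expCfg A * V₀) q κ (boxVec L r) : 𝔸ˣ) : 𝔸) - 1‖ ≤ ρ)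
    (hWρ₀ : ∀ r : Fin d → Fin L, ‖((Wcx L V₀ q κ (boxVec L r) : 𝔸ˣ) : 𝔸) - 1‖ ≤ ρ)
    (htm : ∀ r : Fin d → Fin L, ‖((tHol V₀ (expCfg A) q (treeWord (boxVec L r)) : 𝔸ˣ) : 𝔸) - 1‖ ≤ ρ)
    (htp : ∀ r : Fin d → Fin L,
      ‖((tHol V₀ (expCfg A) (q + (L : ℤ) • e κ) (treeWord (boxVec L r)) : 𝔸ˣ) : 𝔸) - 1‖ ≤ ρ)
    (hQρ : ‖((dbavgCov L V₀ (expCfg A) q κ : 𝔸ˣ) : 𝔸) - 1‖ ≤ ρ) :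
    Qcov L V₀ A q κ ∈ 𝔤 :=
  hΛ _ (dbavgCov_mem hE hΛ hV₀ (expCfg_mem hE hA) q κ hWρ₁ hWρ₀ htm htp) hQρ

end Membership

/-! ## §2 The real ray `V₁ = e^{sA}`: the chart conditions hold for small `s` -/

section Ray

variable {𝔸 : Type*} [NormedRing 𝔸] [NormedAlgebra ℂ 𝔸] [NormOneClass 𝔸] [CompleteSpace 𝔸]
variable {L : ℕ}

omit [NormedAlgebra ℂ 𝔸] [NormOneClass 𝔸] [CompleteSpace 𝔸] in
/-- restriction of a complex curve, continuous at `0`, to the real ray. [folklore] -/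
private theorem tendsto_real_ray {f : ℂ → 𝔸} (hf : ContinuousAt f 0) :
    Tendsto (fun s : ℝ => f (s : ℂ)) (𝓝 0) (𝓝 (f 0)) := by
  have h2 : Tendsto (fun s : ℝ => (s : ℂ)) (𝓝 0) (𝓝 0) := by
    simpa only [Complex.ofReal_zero] using Complex.continuous_ofReal.tendsto 0
  exact hf.tendsto.comp h2

omit [NormedAlgebra ℂ 𝔸] [NormOneClass 𝔸] [CompleteSpace 𝔸] in
/-- if a curve `g` is continuous at `0` along the real ray with `‖g(0) − 1‖ < ρ`, then `‖g(s) − 1‖ ≦ ρ` for small real `s`.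
[folklore] -/
private theorem eventually_norm_sub_one_le {g : ℂ → 𝔸} (hg : ContinuousAt g 0) {ρ : ℝ} (h0 : ‖g 0 - 1‖ < ρ) :
    ∀ᶠ s : ℝ in 𝓝 0, ‖g (s : ℂ) - 1‖ ≤ ρ := by
  have ht : Tendsto (fun s : ℝ => ‖g (s : ℂ) - 1‖) (𝓝 0) (𝓝 ‖g 0 - 1‖) :=
    ((tendsto_real_ray hg).sub_const 1).norm
  exact (ht.eventually (Iio_mem_nhds h0)).mono fun s hs => le_of_lt hs

omit [NormOneClass 𝔸] in
/-- along `V₁ = e^{sA}` the block loops of `V₁V₀` at `c` stay within `ρ` of `1` for small real `s`, if those of `V₀` are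
strictly within `ρ` (continuity: `hasDerivAt_Wcx_expCfg`). [cite: Balaban1985Averaging, (113)-(115) p.34, (42) p.23] -/
theorem eventually_norm_Wcx_expCfg_le (V₀ : Site d → Fin d → 𝔸ˣ) (A : Site d → Fin d → 𝔸) (q : Site d) (κ : Fin d)
    {ρ : ℝ} (hWρ : ∀ r : Fin d → Fin L, ‖((Wcx L V₀ q κ (boxVec L r) : 𝔸ˣ) : 𝔸) - 1‖ < ρ) :
    ∀ᶠ s : ℝ in 𝓝 0, ∀ r : Fin d → Fin L,
      ‖((Wcx L (expCfg ((s : ℂ) • A) * V₀) q κ (boxVec L r) : 𝔸ˣ) : 𝔸) - 1‖ ≤ ρ := by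
  refine eventually_all.2 fun r => ?_
  have hc := (hasDerivAt_Wcx_expCfg L V₀ A q κ (boxVec L r)).continuousAt
  have h0 : ‖((Wcx L (expCfg ((0 : ℂ) • A) * V₀) q κ (boxVec L r) : 𝔸ˣ) : 𝔸) - 1‖ < ρ := by
    rw [expCfg_zero_smul_mul]; exact hWρ r
  exact eventually_norm_sub_one_le hc h0

omit [NormOneClass 𝔸] in
/-- along `V₁ = e^{sA}` the twisted transports `(R_{0,y}e^{sA})(Γ_{y,x})` stay within `ρ > 0` of `1` for small real `s`
(they equal `1` at `s = 0`; continuity: `hasDerivAt_tHol_expCfg`). [cite: Balaban1985Averaging, (58) p.27, (111) p.34] -/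
theorem eventually_norm_tHol_expCfg_le (V₀ : Site d → Fin d → 𝔸ˣ) (A : Site d → Fin d → 𝔸) (y : Site d) {ρ : ℝ}
    (hρ : 0 < ρ) :
    ∀ᶠ s : ℝ in 𝓝 0, ∀ r : Fin d → Fin L,
      ‖((tHol V₀ (expCfg ((s : ℂ) • A)) y (treeWord (boxVec L r)) : 𝔸ˣ) : 𝔸) - 1‖ ≤ ρ := by
  refine eventually_all.2 fun r => ?_
  have hc := (hasDerivAt_tHol_expCfg V₀ A y (treeWord (boxVec L r))).continuousAt
  have h0 : ‖((tHol V₀ (expCfg ((0 : ℂ) • A)) y (treeWord (boxVec L r)) : 𝔸ˣ) : 𝔸) - 1‖ < ρ := by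
    rw [tHol_expCfg_zero_smul, Units.val_one, sub_self, norm_zero]; exact hρ
  exact eventually_norm_sub_one_le hc h0

/-- the double-bar average `V̿₁(c)` (89) of `V₁ = e^{tA}` is continuous in `t` at `0` (product of the two frames and `Ṽ₁(c)`,
each differentiable there by the lineage's lemmas), under `‖W_x(V₀) − 1‖ < 1` on `B(c₋)`.
[cite: Balaban1985Averaging, (89) p.31, (120) p.35] -/
theorem continuousAt_dbavgCov_expCfg (V₀ : Site d → Fin d → 𝔸ˣ) (A : Site d → Fin d → 𝔸) (q : Site d) (κ : Fin d)
    (hW : ∀ r : Fin d → Fin L, ‖((Wcx L V₀ q κ (boxVec L r) : 𝔸ˣ) : 𝔸) - 1‖ < 1) :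
    ContinuousAt (fun t : ℂ => ((dbavgCov L V₀ (expCfg (t • A)) q κ : 𝔸ˣ) : 𝔸)) 0 := by
  have h1 := hasDerivAt_wframe_inv_expCfg L V₀ A q
  have hD := hasDerivAt_tild_expCfg L V₀ A q κ hW
  have h3 := hasDerivAt_conjR_comp (bavg L V₀ q κ) (hasDerivAt_wframe_expCfg L V₀ A (q + (L : ℤ) • e κ))
  have h := ((h1.fun_mul hD).fun_mul h3).continuousAt
  have hval : (fun t : ℂ => ((dbavgCov L V₀ (expCfg (t • A)) q κ : 𝔸ˣ) : 𝔸))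
      = fun t : ℂ => (((wframe L V₀ (expCfg (t • A)) q)⁻¹ : 𝔸ˣ) : 𝔸) * ((tild L V₀ (expCfg (t • A)) q κ : 𝔸ˣ) : 𝔸)
          * conjR (bavg L V₀ q κ) ((wframe L V₀ (expCfg (t • A)) (q + (L : ℤ) • e κ) : 𝔸ˣ) : 𝔸) := by
    funext t
    rw [dbavgCov_apply, Units.val_mul, Units.val_mul, conjR_apply, Rc_apply, Units.val_mul, Units.val_mul]
  rw [hval]
  exact h

/-- along `V₁ = e^{sA}` the double-bar average `V̿₁(c)` stays within `ρ > 0` of `1` for small real `s` (it equals `1` at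
`s = 0`). [cite: Balaban1985Averaging, (89) p.31, (121) p.36] -/
theorem eventually_norm_dbavgCov_expCfg_le (V₀ : Site d → Fin d → 𝔸ˣ) (A : Site d → Fin d → 𝔸) (q : Site d)
    (κ : Fin d) (hW : ∀ r : Fin d → Fin L, ‖((Wcx L V₀ q κ (boxVec L r) : 𝔸ˣ) : 𝔸) - 1‖ < 1) {ρ : ℝ} (hρ : 0 < ρ) :
    ∀ᶠ s : ℝ in 𝓝 0, ‖((dbavgCov L V₀ (expCfg ((s : ℂ) • A)) q κ : 𝔸ˣ) : 𝔸) - 1‖ ≤ ρ := by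
  have hc := continuousAt_dbavgCov_expCfg V₀ A q κ hW
  have h0 : ‖((dbavgCov L V₀ (expCfg ((0 : ℂ) • A)) q κ : 𝔸ˣ) : 𝔸) - 1‖ < ρ := by
    rw [zero_smul, expCfg_zero, dbavgCov_one_right, Units.val_one, sub_self, norm_zero]; exact hρ
  exact eventually_norm_sub_one_le hc h0

variable {H : Subgroup 𝔸ˣ} {𝔤 : Submodule ℝ 𝔸} {ρ : ℝ}

/-- **`Q(V₀, sA, c) ∈ 𝔤` FOR SMALL REAL `s`**: `A` `𝔤`-valued, `V₀` `H`-valued with block loops at `c` within `min(1, ρ)` of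
`1`, `(H, 𝔤, ρ)` an exponential/logarithmic chart ((E), (Λ)). [cite: Balaban1985Averaging, (121) p.36, p.20, (21)-(23) p.21]
[cite: Balaban1985UV3, p.271 (after (62))] -/
theorem eventually_Qcov_mem (hE : ∀ X ∈ 𝔤, expUnit X ∈ H)
    (hΛ : ∀ u : 𝔸ˣ, u ∈ H → ‖(u : 𝔸) - 1‖ ≤ ρ → mlog (u : 𝔸) ∈ 𝔤) (hρ : 0 < ρ)
    {V₀ : Site d → Fin d → 𝔸ˣ} (hV₀ : ∀ z μ, V₀ z μ ∈ H) {A : Site d → Fin d → 𝔸} (hA : ∀ z μ, A z μ ∈ 𝔤)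
    (q : Site d) (κ : Fin d) (hW : ∀ r : Fin d → Fin L, ‖((Wcx L V₀ q κ (boxVec L r) : 𝔸ˣ) : 𝔸) - 1‖ < 1)
    (hWρ : ∀ r : Fin d → Fin L, ‖((Wcx L V₀ q κ (boxVec L r) : 𝔸ˣ) : 𝔸) - 1‖ < ρ) :
    ∀ᶠ s : ℝ in 𝓝 0, Qcov L V₀ ((s : ℂ) • A) q κ ∈ 𝔤 := by
  filter_upwards [eventually_norm_Wcx_expCfg_le V₀ A q κ hWρ, eventually_norm_tHol_expCfg_le V₀ A q hρ,
    eventually_norm_tHol_expCfg_le (L := L) V₀ A (q + (L : ℤ) • e κ) hρ,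
    eventually_norm_dbavgCov_expCfg_le V₀ A q κ hW hρ] with s h1 h2 h3 h4
  exact Qcov_mem hE hΛ hV₀ (A := (s : ℂ) • A)
    (fun z μ => by rw [Pi.smul_apply, Pi.smul_apply, Complex.coe_smul]; exact 𝔤.smul_mem s (hA z μ))
    q κ h1 (fun r => (hWρ r).le) h2 h3 h4

end Ray

/-! ## §3 `L(Q(V₀)A)_c ∈ 𝔤` and `S(V₀, b₀(c))𝔤 ⊆ 𝔤` (p. 271 «acting on the Lie algebra 𝔤») -/

section Main

variable {𝔸 : Type*} [NormedRing 𝔸] [NormedAlgebra ℂ 𝔸] [NormOneClass 𝔸] [CompleteSpace 𝔸]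
variable {L : ℕ} {H : Subgroup 𝔸ˣ} {𝔤 : Submodule ℝ 𝔸} {ρ : ℝ}

/-- the real ray approaches `0` through non-zero complex numbers. [folklore] -/
private theorem tendsto_ofReal_nhdsNE : Tendsto (fun s : ℝ => (s : ℂ)) (𝓝[≠] 0) (𝓝[≠] 0) :=
  tendsto_nhdsWithin_iff.2
    ⟨(by simpa only [Complex.ofReal_zero] using Complex.continuous_ofReal.tendsto 0 :
        Tendsto (fun s : ℝ => (s : ℂ)) (𝓝 0) (𝓝 0)).mono_left nhdsWithin_le_nhds,
      eventually_nhdsWithin_of_forall fun s hs => by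
        simpa only [Set.mem_compl_iff, Set.mem_singleton_iff, Complex.ofReal_eq_zero] using hs⟩

/-- **THE LINEAR PART «L(Q(V₀)A)_c» (122) IS `𝔤`-VALUED** for a `𝔤`-valued `A` at an `H`-valued background whose block
loops at `c` lie within `min(1, ρ)` of `1`, `(H, 𝔤, ρ)` an exponential/logarithmic chart with `𝔤` closed: it is the limit of
`s⁻¹·Q(V₀, sA, c) ∈ 𝔤` along real `s → 0` (`hasDerivAt_Qcov`, `eventually_Qcov_mem`), and `𝔤` is closed.
[cite: Balaban1985Averaging, (122) p.36, p.20, (21)-(23) p.21] [cite: Balaban1985UV3, p.271 (after (62))] -/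
theorem linQcov_mem (h𝔤c : IsClosed (𝔤 : Set 𝔸)) (hE : ∀ X ∈ 𝔤, expUnit X ∈ H)
    (hΛ : ∀ u : 𝔸ˣ, u ∈ H → ‖(u : 𝔸) - 1‖ ≤ ρ → mlog (u : 𝔸) ∈ 𝔤) (hρ : 0 < ρ)
    {V₀ : Site d → Fin d → 𝔸ˣ} (hV₀ : ∀ z μ, V₀ z μ ∈ H) {A : Site d → Fin d → 𝔸} (hA : ∀ z μ, A z μ ∈ 𝔤)
    (q : Site d) (κ : Fin d) (hW : ∀ r : Fin d → Fin L, ‖((Wcx L V₀ q κ (boxVec L r) : 𝔸ˣ) : 𝔸) - 1‖ < 1)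
    (hWρ : ∀ r : Fin d → Fin L, ‖((Wcx L V₀ q κ (boxVec L r) : 𝔸ˣ) : 𝔸) - 1‖ < ρ) :
    linQcov L V₀ A q κ ∈ 𝔤 := by
  set f : ℂ → 𝔸 := fun t => Qcov L V₀ (t • A) q κ with hf
  have hder : HasDerivAt f (linQcov L V₀ A q κ) 0 := by
    unfold linQcov
    exact (hasDerivAt_Qcov L V₀ A q κ hW).differentiableAt.hasDerivAt
  have f0 : f 0 = 0 := by simp only [hf, zero_smul, Qcov_zero]
  -- the slope along the real ray tends to the derivative
  have hslope : Tendsto (fun s : ℝ => ((s : ℂ)⁻¹) • f (s : ℂ)) (𝓝[≠] 0) (𝓝 (linQcov L V₀ A q κ)) := by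
    have h1 := hder.tendsto_slope_zero
    simp only [zero_add, f0, sub_zero] at h1
    exact h1.comp tendsto_ofReal_nhdsNE
  -- and is eventually in `𝔤`
  have hmem : ∀ᶠ s : ℝ in 𝓝[≠] 0, ((s : ℂ)⁻¹) • f (s : ℂ) ∈ 𝔤 := by
    have hev := eventually_Qcov_mem hE hΛ hρ hV₀ hA q κ hW hWρ
    refine (hev.filter_mono nhdsWithin_le_nhds).mono fun s hs => ?_
    rw [← Complex.ofReal_inv, Complex.coe_smul]
    exact 𝔤.smul_mem _ hs
  exact h𝔤c.mem_of_tendsto hslope hmem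

omit [NormOneClass 𝔸] [CompleteSpace 𝔸] in
/-- the single-bond field carrying `X ∈ 𝔤` (and `0` elsewhere) is `𝔤`-valued. [folklore] -/
private theorem bondField_mem (z₀ : Site d) (μ₀ : Fin d) {X : 𝔸} (hX : X ∈ 𝔤) : ∀ z μ, bondField z₀ μ₀ X z μ ∈ 𝔤 := by
  intro z μ
  unfold bondField
  split_ifs
  exacts [hX, 𝔤.zero_mem]

/-- **`S(V₀, b₀(c))𝔤 ⊆ 𝔤` — «a linear operator S(V^{(k)}, b₀(c)) acting on the Lie algebra 𝔤» (p. 271)**: the hypothesis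
`h𝔤` of `B10Eq61SpineCoefficient.fullCoeffOn` DERIVED for every `H`-valued background whose block loops at `c` lie within
`min(1, ρ)` of `1`, `(H, 𝔤, ρ)` an exponential/logarithmic chart of the gauge group ([4] p. 20–21) with `𝔤` closed.
[cite: Balaban1985UV3, p.271 (after (62))] [cite: Balaban1985Averaging, (122), (124) p.36, p.20, (21)-(23) p.21] -/
theorem fullCoeff_mem (h𝔤c : IsClosed (𝔤 : Set 𝔸)) (hE : ∀ X ∈ 𝔤, expUnit X ∈ H)
    (hΛ : ∀ u : 𝔸ˣ, u ∈ H → ‖(u : 𝔸) - 1‖ ≤ ρ → mlog (u : 𝔸) ∈ 𝔤) (hρ : 0 < ρ)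
    {V₀ : Site d → Fin d → 𝔸ˣ} (hV₀ : ∀ z μ, V₀ z μ ∈ H) (y : Site d) (κ : Fin d)
    (hW : ∀ r : Fin d → Fin L, ‖((Wcx L V₀ (corner L y) κ (boxVec L r) : 𝔸ˣ) : 𝔸) - 1‖ < 1)
    (hWρ : ∀ r : Fin d → Fin L, ‖((Wcx L V₀ (corner L y) κ (boxVec L r) : 𝔸ˣ) : 𝔸) - 1‖ < ρ) :
    ∀ X ∈ 𝔤, fullCoeff L V₀ y κ X ∈ 𝔤 := fun _ hX =>
  linQcov_mem h𝔤c hE hΛ hρ hV₀ (bondField_mem _ _ hX) (corner L y) κ hW hWρ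

end Main

/-! ## §4 The dictionary to the tree's `LogChart` ([Hall2015] Thm. 3.42 as data) -/

section Chart

variable {𝔸 : Type*} [NormedRing 𝔸] [NormedAlgebra ℂ 𝔸] [NormOneClass 𝔸] [CompleteSpace 𝔸]

omit [NormOneClass 𝔸] in
/-- **the Lie algebra of a log-chart is CLOSED** (it is `{X | e^{tX} ∈ G ∀ t}` with `G` closed,
`LogChart.mem_lie_iff_forall_exp_smul_mem`). [cite: Hall2015, Def. 3.18, Cor. 3.44] -/
theorem _root_.Literature.MathematicalPhysics.QuantumFieldTheory.Balaban1983to89.LogChart.isClosed_lie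
    (G : LogChart 𝔸) : IsClosed (G.lie : Set 𝔸) := by
  have hset : (G.lie : Set 𝔸) = ⋂ t : ℝ, (fun X : 𝔸 => exp (t • X)) ⁻¹' G.carrier := by
    ext X
    simp only [SetLike.mem_coe, Set.mem_iInter, Set.mem_preimage]
    exact G.mem_lie_iff_forall_exp_smul_mem
  rw [hset]
  refine isClosed_iInter fun t => ?_
  letI : NormedAlgebra ℚ 𝔸 := NormedAlgebra.restrictScalars ℚ ℂ 𝔸
  exact G.isClosed.preimage (exp_continuous.comp (continuous_const.smul continuous_id))

variable {H : Subgroup 𝔸ˣ}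

omit [NormOneClass 𝔸] in
/-- (E) from the chart: `exp X ∈ H` for `X ∈ 𝔤` — for the subgroup `H` of units lying in `G`.
[cite: Balaban1985Averaging, p.20] [cite: Hall2015, Cor. 3.44] -/
theorem expUnit_mem_of_logChart (G : LogChart 𝔸) (hHG : ∀ u : 𝔸ˣ, u ∈ H ↔ (u : 𝔸) ∈ G.carrier) :
    ∀ X ∈ G.lie, expUnit X ∈ H := fun _ hX => (hHG _).2 (G.exp_mem hX)

omit [NormOneClass 𝔸] [CompleteSpace 𝔸] in
/-- (Λ) from the chart: `log u ∈ 𝔤` for `u ∈ H`, `‖u − 1‖ ≦ ρ`. [cite: Balaban1985Averaging, (21)-(23) p.21] [cite: Hall2015, Thm. 3.42] -/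
theorem mlog_mem_of_logChart (G : LogChart 𝔸) (hHG : ∀ u : 𝔸ˣ, u ∈ H ↔ (u : 𝔸) ∈ G.carrier) :
    ∀ u : 𝔸ˣ, u ∈ H → ‖(u : 𝔸) - 1‖ ≤ G.ρ → mlog (u : 𝔸) ∈ G.lie := fun _ hu hρ => G.mlog_mem ((hHG _).1 hu) hρ

omit [NormOneClass 𝔸] in
/-- **`𝔤` IS `Ad(H)`-STABLE**: `R(u)X = uXu⁻¹ ∈ 𝔤` for `u ∈ H`, `X ∈ 𝔤` (`e^{t·uXu⁻¹} = u e^{tX} u⁻¹ ∈ G`) — the hypothesis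
`hst` of `B10Eq61SpineCoefficient` §9, derived. [cite: Balaban1985Averaging, (8) p.18, p.20] [cite: Hall2015, Def. 3.18] -/
theorem _root_.Literature.MathematicalPhysics.QuantumFieldTheory.Balaban1983to89.LogChart.conjR_mem_lie
    (G : LogChart 𝔸) (hHG : ∀ u : 𝔸ˣ, u ∈ H ↔ (u : 𝔸) ∈ G.carrier) :
    ∀ u : 𝔸ˣ, u ∈ H → ∀ X ∈ G.lie, conjR u X ∈ G.lie := by
  intro u hu X hX
  rw [G.mem_lie_iff_forall_exp_smul_mem]
  intro t
  letI : NormedAlgebra ℚ 𝔸 := NormedAlgebra.restrictScalars ℚ ℂ 𝔸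
  rw [← conjR_smul_real, conjR_apply, exp_units_conj]
  exact G.mul_mem (G.mul_mem ((hHG _).1 hu) ((G.mem_lie_iff_forall_exp_smul_mem).1 hX t))
    ((hHG _).1 (H.inv_mem hu))

variable {L : ℕ}

/-- **`S(V₀, b₀(c))𝔤 ⊆ 𝔤` FOR THE GROUP OF A LOG-CHART**: `V₀` with values in `H` (the units lying in `G`), block loops at
`c` within `min(1, ρ_G)` of `1`. [cite: Balaban1985UV3, p.271 (after (62))] [cite: Balaban1985Averaging, (122), (124) p.36]
[cite: Hall2015, Thm. 3.42] -/
theorem fullCoeff_mem_lie (G : LogChart 𝔸) (hHG : ∀ u : 𝔸ˣ, u ∈ H ↔ (u : 𝔸) ∈ G.carrier)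
    {V₀ : Site d → Fin d → 𝔸ˣ} (hV₀ : ∀ z μ, V₀ z μ ∈ H) (y : Site d) (κ : Fin d)
    (hW : ∀ r : Fin d → Fin L, ‖((Wcx L V₀ (corner L y) κ (boxVec L r) : 𝔸ˣ) : 𝔸) - 1‖ < 1)
    (hWρ : ∀ r : Fin d → Fin L, ‖((Wcx L V₀ (corner L y) κ (boxVec L r) : 𝔸ˣ) : 𝔸) - 1‖ < G.ρ) :
    ∀ X ∈ G.lie, fullCoeff L V₀ y κ X ∈ G.lie :=
  fullCoeff_mem G.isClosed_lie (expUnit_mem_of_logChart G hHG) (mlog_mem_of_logChart G hHG) G.ρ_pos hV₀ y κ hW hWρ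

/-- the same for a general `𝔤`-valued `A`: «L(Q(V₀)A)_c» `∈ 𝔤`. [cite: Balaban1985Averaging, (122) p.36] [cite: Hall2015, Thm. 3.42] -/
theorem linQcov_mem_lie (G : LogChart 𝔸) (hHG : ∀ u : 𝔸ˣ, u ∈ H ↔ (u : 𝔸) ∈ G.carrier)
    {V₀ : Site d → Fin d → 𝔸ˣ} (hV₀ : ∀ z μ, V₀ z μ ∈ H) {A : Site d → Fin d → 𝔸} (hA : ∀ z μ, A z μ ∈ G.lie)
    (q : Site d) (κ : Fin d) (hW : ∀ r : Fin d → Fin L, ‖((Wcx L V₀ q κ (boxVec L r) : 𝔸ˣ) : 𝔸) - 1‖ < 1)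
    (hWρ : ∀ r : Fin d → Fin L, ‖((Wcx L V₀ q κ (boxVec L r) : 𝔸ˣ) : 𝔸) - 1‖ < G.ρ) :
    linQcov L V₀ A q κ ∈ G.lie :=
  linQcov_mem G.isClosed_lie (expUnit_mem_of_logChart G hHG) (mlog_mem_of_logChart G hHG) G.ρ_pos hV₀ hA q κ hW hWρ

/-- **THE CHART-SIZED BLOCK-LOOP REGULARITY FROM THE PLAQUETTE REGULARITY (44)/(109)**, by Prop. 1 of [4] in the
lineage's quantified form `B7Prop2Explicit.norm_Wcx_sub_one_le` (`‖V₀(Γ_{c,x})V₀(c)⁻¹ − 1‖ ≦ 16(d+1)(d+4)L²α₀` under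
`512(d+1)(d+4)L²α₀ ≦ 1`): if moreover `16(d+1)(d+4)L²α₀ < ρ`, the block loops lie strictly within `ρ` of `1` — print's
«α₀ sufficiently small» (p. 25 of [4]: «|V₀(Γ_{c,x}) − 1| < … = O(1)L²α₀»). [cite: Balaban1985Averaging, p.25 (displays before (47)), (44) p.24, (109) p.34] -/
theorem norm_Wcx_sub_one_lt_of_plaquette (hL : 1 ≤ L) {V₀ : Site d → Fin d → 𝔸ˣ} (hV₀ : ∀ x κ, V₀ x κ ∈ U1 𝔸)
    {α₀ ρ : ℝ} (hα₀ : 0 ≤ α₀) (hsmall : 512 * (d + 1) * (d + 4) * (L : ℝ) ^ 2 * α₀ ≤ 1)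
    (hρ : 16 * (d + 1) * (d + 4) * (L : ℝ) ^ 2 * α₀ < ρ)
    (h44 : ∀ (x : Site d) (κ κ' : Fin d), κ ≠ κ' → ‖((hol V₀ x (plaqWord κ κ') : 𝔸ˣ) : 𝔸) - 1‖ ≤ α₀)
    (q : Site d) (κ : Fin d) :
    ∀ r : Fin d → Fin L, ‖((Wcx L V₀ q κ (boxVec L r) : 𝔸ˣ) : 𝔸) - 1‖ < ρ := fun r =>
  (norm_Wcx_sub_one_le L hL V₀ hV₀ hα₀ hsmall h44 q κ r).trans_lt (by linarith)

/-- **`S(V₀, b₀(c))𝔤 ⊆ 𝔤` FROM THE PLAQUETTE REGULARITY (44)/(109) ALONE**: `V₀` with values in the group `H ≤ U1` of a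
log-chart `G`, `|V₀(∂p) − 1| ≦ α₀` with `512(d+1)(d+4)L²α₀ ≦ 1` and `16(d+1)(d+4)L²α₀ < ρ_G` (both block-loop windows of
`fullCoeff_mem_lie` then follow from Prop. 1 of [4]). [cite: Balaban1985UV3, p.271 (after (62))]
[cite: Balaban1985Averaging, (44) p.24, p.25, (109) p.34, (122), (124) p.36] [cite: Hall2015, Thm. 3.42] -/
theorem fullCoeff_mem_lie_of_plaquette (hL : 1 ≤ L) (G : LogChart 𝔸) (hHG : ∀ u : 𝔸ˣ, u ∈ H ↔ (u : 𝔸) ∈ G.carrier)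
    (hH : H ≤ U1 𝔸) {V₀ : Site d → Fin d → 𝔸ˣ} (hV₀ : ∀ z μ, V₀ z μ ∈ H) {α₀ : ℝ} (hα₀ : 0 ≤ α₀)
    (hsmall : 512 * (d + 1) * (d + 4) * (L : ℝ) ^ 2 * α₀ ≤ 1) (hρ : 16 * (d + 1) * (d + 4) * (L : ℝ) ^ 2 * α₀ < G.ρ)
    (h44 : ∀ (x : Site d) (κ κ' : Fin d), κ ≠ κ' → ‖((hol V₀ x (plaqWord κ κ') : 𝔸ˣ) : 𝔸) - 1‖ ≤ α₀)
    (y : Site d) (κ : Fin d) : ∀ X ∈ G.lie, fullCoeff L V₀ y κ X ∈ G.lie :=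
  have hU : ∀ x κ, V₀ x κ ∈ U1 𝔸 := fun x κ => hH (hV₀ x κ)
  have h1 : 16 * (d + 1) * (d + 4) * (L : ℝ) ^ 2 * α₀ < 1 := by
    have : (0 : ℝ) ≤ (d + 1) * (d + 4) * (L : ℝ) ^ 2 * α₀ := by positivity
    nlinarith
  fullCoeff_mem_lie G hHG hV₀ y κ (norm_Wcx_sub_one_lt_of_plaquette hL hU hα₀ hsmall h1 h44 _ κ)
    (norm_Wcx_sub_one_lt_of_plaquette hL hU hα₀ hsmall hρ h44 _ κ)

end Chart

/-! ## §5 Consequences for (61): §9c/§9d of `B10Eq61SpineCoefficient` with `h𝔤` and `hst` supplied -/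

section Det

variable {𝔸 : Type*} [NormedRing 𝔸] [NormedAlgebra ℂ 𝔸] [NormOneClass 𝔸] [CompleteSpace 𝔸]
variable {L : ℕ} {H : Subgroup 𝔸ˣ}

/-- **`det S(V_k^{(k)}, b₀(c)) ≠ 0` ON THE LIE ALGEBRA OF THE GAUGE GROUP**, hypothesis-free in `h𝔤`: at a background with
values in the group `H ≤ U1` of a log-chart `G`, regular at `c` (block loops within `ε ≦ 1/8`, `50(d+1)ε < L^{−d}`, and
within `ρ_G`), the full `b₀(c)`-coefficient restricted to the finite-dimensional `𝔤 = G.lie` — which it preserves,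
`fullCoeff_mem_lie` — has non-zero determinant (`B10Eq61SpineCoefficient.det_fullCoeffOn_ne_zero`).
[cite: Balaban1985UV3, p.271 (after (62))] [cite: Balaban1985BackgroundPropagators, p.428 (after (3.156))] [cite: Hall2015, Thm. 3.42] -/
theorem det_fullCoeffOn_ne_zero_of_logChart (hL : 1 ≤ L) (G : LogChart 𝔸) [FiniteDimensional ℝ G.lie]
    (hHG : ∀ u : 𝔸ˣ, u ∈ H ↔ (u : 𝔸) ∈ G.carrier) (hH : H ≤ U1 𝔸)
    {V₀ : Site d → Fin d → 𝔸ˣ} (hV₀ : ∀ z μ, V₀ z μ ∈ H) (y : Site d) (κ : Fin d) {ε : ℝ} (hε0 : 0 ≤ ε) (hε : ε ≤ 1 / 8)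
    (hW : ∀ r : Fin d → Fin L, ‖((Wcx L V₀ (corner L y) κ (boxVec L r) : 𝔸ˣ) : 𝔸) - 1‖ ≤ ε)
    (hsmall : 50 * (d + 1) * ε < (((L : ℝ) ^ d)⁻¹))
    (hW1 : ∀ r : Fin d → Fin L, ‖((Wcx L V₀ (corner L y) κ (boxVec L r) : 𝔸ˣ) : 𝔸) - 1‖ < 1)
    (hWρ : ∀ r : Fin d → Fin L, ‖((Wcx L V₀ (corner L y) κ (boxVec L r) : 𝔸ˣ) : 𝔸) - 1‖ < G.ρ) :
    LinearMap.det (fullCoeffOn L G.lie V₀ y κ hW1 (fullCoeff_mem_lie G hHG hV₀ y κ hW1 hWρ)) ≠ 0 :=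
  det_fullCoeffOn_ne_zero hL G.lie (fun z μ => hH (hV₀ z μ)) y κ hε0 hε hW hsmall hW1 _

/-- … and it is BIJECTIVE on `𝔤` (the `b₀(c)`-equation is uniquely solvable in the Lie algebra, [5] p. 428).
[cite: Balaban1985BackgroundPropagators, p.428 (after (3.156))] [cite: Balaban1985UV3, p.271 (after (62))] [cite: Hall2015, Thm. 3.42] -/
theorem fullCoeffOn_bijective_of_logChart (hL : 1 ≤ L) (G : LogChart 𝔸) [FiniteDimensional ℝ G.lie]
    (hHG : ∀ u : 𝔸ˣ, u ∈ H ↔ (u : 𝔸) ∈ G.carrier) (hH : H ≤ U1 𝔸)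
    {V₀ : Site d → Fin d → 𝔸ˣ} (hV₀ : ∀ z μ, V₀ z μ ∈ H) (y : Site d) (κ : Fin d) {ε : ℝ} (hε0 : 0 ≤ ε) (hε : ε ≤ 1 / 8)
    (hW : ∀ r : Fin d → Fin L, ‖((Wcx L V₀ (corner L y) κ (boxVec L r) : 𝔸ˣ) : 𝔸) - 1‖ ≤ ε)
    (hsmall : 50 * (d + 1) * ε < (((L : ℝ) ^ d)⁻¹))
    (hW1 : ∀ r : Fin d → Fin L, ‖((Wcx L V₀ (corner L y) κ (boxVec L r) : 𝔸ˣ) : 𝔸) - 1‖ < 1)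
    (hWρ : ∀ r : Fin d → Fin L, ‖((Wcx L V₀ (corner L y) κ (boxVec L r) : 𝔸ˣ) : 𝔸) - 1‖ < G.ρ) :
    Function.Bijective (fullCoeffOn L G.lie V₀ y κ hW1 (fullCoeff_mem_lie G hHG hV₀ y κ hW1 hWρ)) :=
  fullCoeffOn_bijective hL G.lie (fun z μ => hH (hV₀ z μ)) y κ hε0 hε hW hsmall hW1 _

/-- **`|det S(V₀^u, b₀(c))|_𝔤 = |det S(V₀, b₀(c))|_𝔤`** — the gauge invariance of the local term `−log|det S|` of p. 271
for `H`-valued gauge transformations, with BOTH structural hypotheses of `B10Eq61SpineCoefficient.abs_det_fullCoeffOn_gaugeAct`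
(`hst`: `Ad(H)`-stability of `𝔤`; `h𝔤`: `S`-stability of `𝔤`) supplied from the chart.
[cite: Balaban1985UV3, p.271 (after (62))] [cite: Balaban1985Averaging, (8) p.18, (45) p.24] [cite: Hall2015, Thm. 3.42] -/
theorem abs_det_fullCoeffOn_gaugeAct_of_logChart (G : LogChart 𝔸) [FiniteDimensional ℝ G.lie]
    (hHG : ∀ u : 𝔸ˣ, u ∈ H ↔ (u : 𝔸) ∈ G.carrier) (hH : H ≤ U1 𝔸)
    {u : Site d → 𝔸ˣ} (hu : ∀ x, u x ∈ H) {V₀ : Site d → Fin d → 𝔸ˣ} (hV₀ : ∀ z μ, V₀ z μ ∈ H) (y : Site d)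
    (κ : Fin d) (hW : ∀ r : Fin d → Fin L, ‖((Wcx L V₀ (corner L y) κ (boxVec L r) : 𝔸ˣ) : 𝔸) - 1‖ < 1)
    (hWρ : ∀ r : Fin d → Fin L, ‖((Wcx L V₀ (corner L y) κ (boxVec L r) : 𝔸ˣ) : 𝔸) - 1‖ < G.ρ) :
    |LinearMap.det (fullCoeffOn L G.lie (gaugeAct u V₀) y κ
        (fun r => (B10Eq61SpineCoefficient.norm_Wcx_gaugeAct_sub_one (fun x => hH (hu x)) V₀ _ κ _).trans_lt (hW r))
        (B10Eq61SpineCoefficient.fullCoeff_gaugeAct_mem G.lie (G.conjR_mem_lie hHG) hu V₀ y κ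
          (fullCoeff_mem_lie G hHG hV₀ y κ hW hWρ)))|
      = |LinearMap.det (fullCoeffOn L G.lie V₀ y κ hW (fullCoeff_mem_lie G hHG hV₀ y κ hW hWρ))| :=
  abs_det_fullCoeffOn_gaugeAct G.lie hH (G.conjR_mem_lie hHG) hu V₀ y κ hW _

end Det

/-! ## §5b Finite-dimensional `𝔸`: every subgroup of `𝔸ˣ` closed in `𝔸`, with its Hall Lie algebra -/

section Closed

variable {𝔸 : Type*} [NormedRing 𝔸] [NormedAlgebra ℂ 𝔸] [NormOneClass 𝔸] [CompleteSpace 𝔸] [FiniteDimensional ℂ 𝔸]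
variable {L : ℕ}

open LogChartClosedSubgroup (unitsSubgroupLogChart unitsSubgroupLogChart_carrier)

/-- **FOR EVERY SUBGROUP `H ≤ 𝔸ˣ` CLOSED IN THE FINITE-DIMENSIONAL `𝔸`** (print's «Lie subgroup G of a unitary group
U(N)», `𝔸 = M_N(ℂ)`) **AND ITS LIE ALGEBRA `𝔤 = {X | e^{tX} ∈ H ∀ t}`**: `S(V₀, b₀(c))𝔤 ⊆ 𝔤` at every `H`-valued background
regular at `c` within the chart radius `ρ_H` of `unitsSubgroupLogChart` (Cartan–von Neumann–Hall, `LogChartClosedSubgroup`).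
[cite: Balaban1985UV3, p.271 (after (62))] [cite: Balaban1985Averaging, p.20] [cite: Hall2015, Thm. 3.42, Def. 3.18] -/
theorem fullCoeff_mem_lie_of_isClosed (H : Subgroup 𝔸ˣ) (hHc : IsClosed (Units.val '' (H : Set 𝔸ˣ)))
    {V₀ : Site d → Fin d → 𝔸ˣ} (hV₀ : ∀ z μ, V₀ z μ ∈ H) (y : Site d) (κ : Fin d)
    (hW : ∀ r : Fin d → Fin L, ‖((Wcx L V₀ (corner L y) κ (boxVec L r) : 𝔸ˣ) : 𝔸) - 1‖ < 1)
    (hWρ : ∀ r : Fin d → Fin L,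
      ‖((Wcx L V₀ (corner L y) κ (boxVec L r) : 𝔸ˣ) : 𝔸) - 1‖ < (unitsSubgroupLogChart H hHc).ρ) :
    ∀ X ∈ (unitsSubgroupLogChart H hHc).lie, fullCoeff L V₀ y κ X ∈ (unitsSubgroupLogChart H hHc).lie :=
  fullCoeff_mem_lie (unitsSubgroupLogChart H hHc)
    (fun u => by
      rw [unitsSubgroupLogChart_carrier]
      refine ⟨fun hu => ⟨u, hu, rfl⟩, ?_⟩
      rintro ⟨v, hv, hvu⟩
      rwa [← Units.ext hvu])
    hV₀ y κ hW hWρ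

end Closed

/-! ## §5c `G = U(N)`, `𝔤 = 𝔲(N)` — print's ambient group ([4] p. 20), with the EXPLICIT chart radius `1/3` of the tree's
`unitaryLogChart` (operator norm (19) of [4]) -/

section Unitary

open scoped Matrix.Norms.L2Operator
open B7Prop2Explicit (unitaryUnits mem_unitaryUnits unitaryUnits_le_U1)

variable {n : Type*} [Fintype n] [DecidableEq n] [Nonempty n]
variable {L : ℕ}

/-- **`S(V₀, b₀(c))𝔲(N) ⊆ 𝔲(N)` FOR UNITARY BACKGROUNDS**: `V₀` with values in `U(N)`, block loops at `c` within `1/3` of `1`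
in the operator norm; `𝔲(N) = {X | X* = −X}` (Mathlib's `skewAdjoint.submodule ℝ`; print's 𝔤 = hermitian matrices times
`i`, the `i` absorbed in the lineage's conventions). [cite: Balaban1985UV3, p.271 (after (62))]
[cite: Balaban1985Averaging, p.20, (19) p.21, (21)-(23) p.21, (122), (124) p.36] -/
theorem fullCoeff_mem_skewAdjoint {V₀ : Site d → Fin d → (Matrix n n ℂ)ˣ}
    (hV₀ : ∀ z μ, V₀ z μ ∈ unitaryUnits (Matrix n n ℂ)) (y : Site d) (κ : Fin d)
    (hWρ : ∀ r : Fin d → Fin L,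
      ‖((Wcx L V₀ (corner L y) κ (boxVec L r) : (Matrix n n ℂ)ˣ) : Matrix n n ℂ) - 1‖ < 1 / 3) :
    ∀ X ∈ skewAdjoint.submodule ℝ (Matrix n n ℂ),
      fullCoeff L V₀ y κ X ∈ skewAdjoint.submodule ℝ (Matrix n n ℂ) :=
  fullCoeff_mem_lie (H := unitaryUnits (Matrix n n ℂ)) (unitaryLogChart n) (fun _ => mem_unitaryUnits) hV₀ y κ
    (fun r => (hWρ r).trans (by norm_num)) hWρ

/-- **`det S(V₀, b₀(c)) ≠ 0` ON `𝔲(N)`** at a unitary background regular at `c` (block loops within `ε ≦ 1/8`,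
`50(d+1)ε < L^{−d}`): every hypothesis of `B10Eq61SpineCoefficient.det_fullCoeffOn_ne_zero` about `𝔤` discharged.
[cite: Balaban1985UV3, p.271 (after (62))] [cite: Balaban1985BackgroundPropagators, p.428 (after (3.156))]
[cite: Balaban1985Averaging, p.20, (21)-(23) p.21] -/
theorem det_fullCoeffOn_ne_zero_unitary (hL : 1 ≤ L) {V₀ : Site d → Fin d → (Matrix n n ℂ)ˣ}
    (hV₀ : ∀ z μ, V₀ z μ ∈ unitaryUnits (Matrix n n ℂ)) (y : Site d) (κ : Fin d) {ε : ℝ} (hε0 : 0 ≤ ε)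
    (hε : ε ≤ 1 / 8)
    (hW : ∀ r : Fin d → Fin L, ‖((Wcx L V₀ (corner L y) κ (boxVec L r) : (Matrix n n ℂ)ˣ) : Matrix n n ℂ) - 1‖ ≤ ε)
    (hsmall : 50 * (d + 1) * ε < (((L : ℝ) ^ d)⁻¹))
    (hW1 : ∀ r : Fin d → Fin L, ‖((Wcx L V₀ (corner L y) κ (boxVec L r) : (Matrix n n ℂ)ˣ) : Matrix n n ℂ) - 1‖ < 1) :
    LinearMap.det (fullCoeffOn L (skewAdjoint.submodule ℝ (Matrix n n ℂ)) V₀ y κ hW1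
        (fullCoeff_mem_skewAdjoint hV₀ y κ fun r => (hW r).trans_lt (by linarith))) ≠ 0 := by
  letI : CStarAlgebra (Matrix n n ℂ) := {}
  exact det_fullCoeffOn_ne_zero hL _ (fun z μ => unitaryUnits_le_U1 (hV₀ z μ)) y κ hε0 hε hW hsmall hW1 _

end Unitary

/-! ## §6 «simple, LOCAL, gauge invariant functions of V^{(k)}» (p. 271): the coefficient — hence `det S(V₀, b₀(c))|_𝔤` —
depends on the background only through the bonds of `B(c₋) ∪ B(c₊)` (locality of (121), [4] p. 34, the lineage's
`B7LocalityGeneral.Qcov_congr`) -/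

section Locality

open B7Prop1Local (AgreeOn bondHi)
open B7LocalityGeneral (Qcov_congr)

variable {𝔸 : Type*} [NormedRing 𝔸] [NormedAlgebra ℂ 𝔸] [NormOneClass 𝔸] [CompleteSpace 𝔸]
variable {L : ℕ}

omit [NormOneClass 𝔸] in
/-- **«L(Q(V₀)A)_c» IS LOCAL IN THE BACKGROUND**: two backgrounds agreeing on the bonds of `B(c₋) ∪ B(c₊)` have the same
linear part at `c` (every `Q(V₀, tA, c)` agrees, `Qcov_congr`; then the `t`-derivatives agree).
[cite: Balaban1985Averaging, (121)-(122) p.36, p.34, p.24] [cite: Balaban1985UV3, p.271 (after (62))] -/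
theorem linQcov_congr (hL : 1 ≤ L) {V₀ V₀' : Site d → Fin d → 𝔸ˣ} (q : Site d) (κ : Fin d)
    (h₀ : AgreeOn q (bondHi L q κ) V₀ V₀') (A : Site d → Fin d → 𝔸) :
    linQcov L V₀ A q κ = linQcov L V₀' A q κ := by
  unfold linQcov
  have h : (fun t : ℂ => Qcov L V₀ (t • A) q κ) = fun t : ℂ => Qcov L V₀' (t • A) q κ :=
    funext fun t => Qcov_congr L hL q κ h₀ fun _ _ _ _ => rfl
  rw [h]

omit [NormOneClass 𝔸] in
/-- **`S(V₀, b₀(c))` IS A LOCAL FUNCTION OF THE BACKGROUND** — «simple, local, gauge invariant functions of V^{(k)}»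
(p. 271), the locality clause: backgrounds agreeing on the bonds of the block pair `B(c₋) ∪ B(c₊)` (`c = ⟨Ly, Ly + Le_κ⟩`)
have the same full `b₀(c)`-coefficient. [cite: Balaban1985UV3, p.271 (after (62))] [cite: Balaban1985Averaging, (121)-(122), (124) p.36, p.34] -/
theorem fullCoeff_congr (hL : 1 ≤ L) {V₀ V₀' : Site d → Fin d → 𝔸ˣ} (y : Site d) (κ : Fin d)
    (h₀ : AgreeOn (corner L y) (bondHi L (corner L y) κ) V₀ V₀') :
    fullCoeff L V₀ y κ = fullCoeff L V₀' y κ :=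
  funext fun _ => linQcov_congr hL (corner L y) κ h₀ _

/-- … hence **`det S(V₀, b₀(c))|_𝔤` (and the local term `−log|det S|`) IS A LOCAL FUNCTION OF THE BACKGROUND**: equal
for two backgrounds agreeing on `B(c₋) ∪ B(c₊)` (whatever regularity/stability witnesses are used for each).
[cite: Balaban1985UV3, p.271 (after (62))] [cite: Balaban1985Averaging, (124) p.36, p.34] -/
theorem det_fullCoeffOn_congr (hL : 1 ≤ L) (𝔤 : Submodule ℝ 𝔸) {V₀ V₀' : Site d → Fin d → 𝔸ˣ} (y : Site d) (κ : Fin d)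
    (h₀ : AgreeOn (corner L y) (bondHi L (corner L y) κ) V₀ V₀')
    (hW : ∀ r : Fin d → Fin L, ‖((Wcx L V₀ (corner L y) κ (boxVec L r) : 𝔸ˣ) : 𝔸) - 1‖ < 1)
    (h𝔤 : ∀ X ∈ 𝔤, fullCoeff L V₀ y κ X ∈ 𝔤)
    (hW' : ∀ r : Fin d → Fin L, ‖((Wcx L V₀' (corner L y) κ (boxVec L r) : 𝔸ˣ) : 𝔸) - 1‖ < 1)
    (h𝔤' : ∀ X ∈ 𝔤, fullCoeff L V₀' y κ X ∈ 𝔤) :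
    LinearMap.det (fullCoeffOn L 𝔤 V₀ y κ hW h𝔤) = LinearMap.det (fullCoeffOn L 𝔤 V₀' y κ hW' h𝔤') := by
  have h : fullCoeffOn L 𝔤 V₀ y κ hW h𝔤 = fullCoeffOn L 𝔤 V₀' y κ hW' h𝔤' :=
    LinearMap.ext fun X => Subtype.ext (by
      rw [B10Eq61SpineCoefficient.fullCoeffOn_apply, B10Eq61SpineCoefficient.fullCoeffOn_apply,
        fullCoeff_congr hL y κ h₀])
  rw [h]

end Locality

end Literature.MathematicalPhysics.QuantumFieldTheory.Balaban1983to89.B10Eq61CoefficientOnLie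

end
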